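import Summits.CriticalPhenomena.PercolationContinuityZ3.Theorems.Transplant.SiteUnfoldDecoy
import Summits.CriticalPhenomena.PercolationContinuityZ3.Theorems.Transplant.SiteHtwBridge
import Literature.Probability.LatticeModels.ProdBernoulliWeightContinuity
import HarnessLib

/-!
# SITE percolation: LEMMA U of the site conditioned slack hierarchy, general `k` — the sum over the decoys
# (measure ↔ weight-sum dictionary for the site worlds, the functional `Φ̃_d`, the accumulated lower-level terms `subT`)
# (WP6 of P1-SITE-Z3 §12/§15; site twin of `Theorems/PercNearOneGluingNoHeavyLowerTailCSHUnfold.lean`)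

builds on p205010 (kernel theorem, internal audit signed; external expert review pending).

* `setIntegral_eq_sum_ind'`, `integral_world_eq_wmeanOff`, `world_cov_eq_wcovOff` — integrals against the site world kernel `prodBernoulli (worldQ Γ q Y ω)`
  (p211418) are the weight-sums `wmeanOff`/`wcovOff` of the configuration with the dead set deleted (via `SiteCovTau.sum_weight_srest_univ`, p213207);
* `phiT Γ q x Y g d K = Φ({d} ∪ K ∪ ∂K)` — the site Lemma-Φ functional (`SiteCSH.phiFun`, p213049) at the dead set of the decoy's cluster value;
  monotone, nonnegative; `phiT_siteCluster`, `covD_phiT_eq`, `avoidConst_eq_div`, `sum_ind_avoid_ne_zero`, `map_fst_decoyList`;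
* `subT` and **`sum_wcov_unfoldT`** — the `{x↮Y}`-average of the world covariance with the unfolded terms `CSH.unfoldT` is `−subT`
  (`decoy_world_term` summed along the decoy list; in the site model no condition on the decoys is needed).
Definitions + proofs (`--supports stmt-CriticalPhenomena-4575 --as helper`); no named facts, no sorries.
[cite: VandenbergHaggstromKahn2005, §2.1 Lemmas 2.3–2.4 (p. 10); §1 display (10) (pp. 7–8)] [cite: KozmaNitzan2024, Conj. 4 (p. 32)]
-/

noncomputable section

namespace Summit.CriticalPhenomena.PercolationContinuityZ3.Theorems.Transplant

namespace SiteCSH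

open MeasureTheory Set
open Literature.Probability.Percolation
open Literature.Probability.Percolation.BHK2006 (weight weight_nonneg ind_inter integral_prodBernoulli_eq_sum)
open Literature.Probability.Percolation.DecisionTree (ind ind_of_mem ind_of_not_mem ind_nonneg)
open Literature.Probability.LatticeModels (prodBernoulli prodBernoulli_real_pos_of_nonempty)
open Summit.CriticalPhenomena.PercolationContinuityZ3.Theorems.CSH (slForm slForm_smul slForm_eq_sum_single cshMarg
  cshMarg_eq_sum_single slForm_jn jn_singleton)
open Summit.CriticalPhenomena.PercolationContinuityZ3.Theorems.SiteTransplant (siteConn)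
open SiteGen (siteCluster_mono' siteCluster_eq_of_mem mem_siteConn_iff_mem_siteCluster)
open SiteBHK (setC)
open scoped Classical

variable {V : Type*} {Γ : SimpleGraph V}

variable [Fintype V]

/-! ### Measure ↔ weight-sum dictionary for the site worlds -/

/-- `∫_E f dμ_q = Σ_ω weight(ω) 1_E(ω) f(ω)`. [folklore] -/
theorem setIntegral_eq_sum_ind' (q : V → unitInterval) (E : Set (Set V)) (f : Set V → ℝ) :
    ∫ ω in E, f ω ∂(prodBernoulli q) = ∑ ω, weight (fun u => (q u : ℝ)) ω * (ind E ω * f ω) := by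
  rw [← SiteCovTau.sum_weight_mul_ind_eq_setIntegral]
  exact Finset.sum_congr rfl fun ω _ => by ring

/-- **World expectations are `wmeanOff`** (site): the expectation under the world kernel `q^ω_Y` is the weight-sum of the configuration
with the dead set deleted. [cite: VandenbergHaggstromKahn2005, §2.1 Lemma 2.3 (p. 10)] -/
theorem integral_world_eq_wmeanOff (q : V → unitInterval) (Y : Set V) (ω : Set V) (F : Set V → ℝ) :
    ∫ η, F η ∂(prodBernoulli (worldQ Γ q Y ω)) = wmeanOff Γ (fun u => (q u : ℝ)) Y F ω := by
  rw [← SiteCovTau.sum_weight_srest_univ q Y ω F]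
  simp only [SiteCovTau.inter_srest_univ_eq_diff]
  rfl

/-- **The world covariance term of the site multi-marker reduction is `wcovOff`.** [cite: VandenbergHaggstromKahn2005, §2.1 Lemma 2.3 (p. 10)] -/
theorem world_cov_eq_wcovOff (q : V → unitInterval) (Y : Set V) (ω : Set V) (G : Set V → ℝ) (C : Set (Set V)) :
    (∫ η in C, G η ∂(prodBernoulli (worldQ Γ q Y ω))) -
        (∫ η, G η ∂(prodBernoulli (worldQ Γ q Y ω))) * (prodBernoulli (worldQ Γ q Y ω)).real C =
      wcovOff Γ (fun u => (q u : ℝ)) Y G (ind C) ω := by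
  rw [← integral_indicator MeasurableSet.of_discrete, ← integral_indicator_one MeasurableSet.of_discrete,
    integral_world_eq_wmeanOff, integral_world_eq_wmeanOff, integral_world_eq_wmeanOff]
  unfold wcovOff
  have e1 : (C.indicator G) = fun β => G β * ind C β := by
    funext β
    by_cases hβ : β ∈ C
    · rw [Set.indicator_of_mem hβ, ind_of_mem hβ, mul_one]
    · rw [Set.indicator_of_notMem hβ, ind_of_not_mem hβ, mul_zero]
  have e2 : (C.indicator (1 : Set V → ℝ)) = ind C := by
    funext β
    by_cases hβ : β ∈ C
    · rw [Set.indicator_of_mem hβ, ind_of_mem hβ, Pi.one_apply]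
    · rw [Set.indicator_of_notMem hβ, ind_of_not_mem hβ]
  rw [e1, e2]

/-! ### The Lemma-Φ functional on the cluster of a decoy -/

omit [Fintype V] in
/-- The dead set of a fixed source set grows with the cluster value. [folklore] -/
theorem deadOf_mono (N : Set V) {W W' : Set V} (h : W ⊆ W') : SiteBHK.deadOf Γ N W ⊆ SiteBHK.deadOf Γ N W' := by
  rintro u (hu | hu | ⟨c, hc, huc⟩)
  · exact Or.inl hu
  · exact Or.inr (Or.inl (h hu))
  · exact Or.inr (Or.inr ⟨c, h hc, huc⟩)

variable (Γ) in
/-- **`Φ̃_d(K) = Φ({d} ∪ K ∪ ∂K)`**: the site Lemma-Φ functional (`SiteCSH.phiFun`, p213049) with the deleted set = the dead set of the decoy's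
cluster value `K` — the functional of the lower-level system with owner `d`. [cite: VandenbergHaggstromKahn2005, §2.1 Lemma 2.4 (p. 10)] -/
def phiT (q : V → unitInterval) (x : V) (Y : Set V) (g : Set V → ℝ) (d : V) (K : Set V) : ℝ :=
  phiFun Γ q x Y g (SiteBHK.deadOf Γ {d} K)

/-- `Φ̃_d` is monotone (site Lemma Φ(b)). [folklore] -/
theorem phiT_mono (q : V → unitInterval) (x : V) (Y : Set V) {g : Set V → ℝ} (hg : Monotone g) (d : V) :
    Monotone (phiT Γ q x Y g d) := fun _ _ hKK' => phiFun_mono q x Y hg (deadOf_mono {d} hKK')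

omit [Fintype V] in
/-- `Φ̃_d ≥ 0` (site Lemma Φ). [folklore] -/
theorem phiT_nonneg (q : V → unitInterval) (x : V) (Y : Set V) {g : Set V → ℝ} (hg : Monotone g) (d : V) (K : Set V) :
    0 ≤ phiT Γ q x Y g d K := phiFun_nonneg q x Y hg _

/-- The dead set of the cluster value of `d` is the dead set `worldDead_{d}`. [folklore] -/
theorem deadOf_siteCluster (d : V) (ζ : Set V) : SiteBHK.deadOf Γ {d} (siteCluster Γ ζ d) = worldDead Γ {d} ζ := by
  rw [worldDead_eq_deadOf, setC_singleton_univ]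

/-- `Φ̃_d(C_d(ζ)) = Φ(C_d(ζ))` (sum level `phiS`). [folklore] -/
theorem phiT_siteCluster (q : V → unitInterval) (x : V) (Y : Set V) (g : Set V → ℝ) (d : V) (ζ : Set V) :
    phiT Γ q x Y g d (siteCluster Γ ζ d) = phiS Γ (fun u => (q u : ℝ)) x Y g d ζ := by
  unfold phiT phiS phiFun
  rw [deadOf_siteCluster, integral_prodBernoulli_eq_sum]

omit [Fintype V] in
/-- The avoidance event in the vocabulary of `SiteCSH.covD` / `avoidConst`. [folklore] -/
theorem setOf_avoid_eq (d : V) (A : Set V) : {ω : Set V | ∀ a ∈ A, a ∉ siteCluster Γ ω d} = avoid Γ d A := rfl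

/-- **The denominator-free covariance of the sub-system is the centred decoy moment** (site): for `E = {d ↮ A}`,
`covD_{d,A}(Φ̃_d)(w') = m₀·P₁(w') − m₁(w')·P₀`. [folklore] -/
theorem covD_phiT_eq (q : V → unitInterval) (x : V) (Y A : Set V) (g : Set V → ℝ) (d w' : V) :
    covD Γ q d A (phiT Γ q x Y g d) w' =
      (∑ ζ, weight (fun u => (q u : ℝ)) ζ * ind (avoid Γ d A) ζ) *
          (∑ ζ, weight (fun u => (q u : ℝ)) ζ *
            (ind (avoid Γ d A ∩ siteConn Γ d w') ζ * phiS Γ (fun u => (q u : ℝ)) x Y g d ζ)) -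
        (∑ ζ, weight (fun u => (q u : ℝ)) ζ * ind (avoid Γ d A ∩ siteConn Γ d w') ζ) *
          (∑ ζ, weight (fun u => (q u : ℝ)) ζ * (ind (avoid Γ d A) ζ * phiS Γ (fun u => (q u : ℝ)) x Y g d ζ)) := by
  unfold covD
  rw [setOf_avoid_eq, ← SiteCovTau.sum_weight_ind_eq_real, ← SiteCovTau.sum_weight_ind_eq_real, setIntegral_eq_sum_ind',
    setIntegral_eq_sum_ind']
  simp only [phiT_siteCluster]
  ring

/-- **The site decoy constant is the ratio of masses** (sum level). [folklore] -/
theorem avoidConst_eq_div (q : V → unitInterval) (d : V) (A : Set V) (w' : V) :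
    avoidConst Γ q d A w' = (∑ ζ, weight (fun u => (q u : ℝ)) ζ * ind (avoid Γ d A ∩ siteConn Γ d w') ζ) /
      ∑ ζ, weight (fun u => (q u : ℝ)) ζ * ind (avoid Γ d A) ζ := by
  unfold avoidConst
  rw [setOf_avoid_eq, ← SiteCovTau.sum_weight_ind_eq_real, ← SiteCovTau.sum_weight_ind_eq_real]

/-- For non-degenerate vertex weights the avoidance mass `μ(d ↮ A) = Σ_ζ w 1{d↮A}` is nonzero (the all-closed configuration avoids
everything). [folklore] -/
theorem sum_ind_avoid_ne_zero (q : V → unitInterval) (hq : ∀ u, 0 < q u ∧ q u < 1) (d : V) (A : Set V) :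
    ∑ ζ, weight (fun u => (q u : ℝ)) ζ * ind (avoid Γ d A) ζ ≠ 0 := by
  rw [SiteCovTau.sum_weight_ind_eq_real]
  have hmem : (∅ : Set V) ∈ avoid Γ d A := fun _ _ h => h.1
  exact (prodBernoulli_real_pos_of_nonempty hq ⟨∅, hmem⟩).ne'

omit [Fintype V] in
/-- The decoys of the site decoy list. [folklore] -/
theorem map_fst_decoyList (q : V → unitInterval) : ∀ (A : Set V) (D : List V), (decoyList Γ q A D).map Prod.fst = D
  | _, [] => rfl
  | A, d :: ds => by simp only [decoyList, List.map_cons, map_fst_decoyList q (insert d A) ds]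

/-! ### Summing the decoy terms along the list (the `Σ_j` of Lemma U) -/

variable (Γ) in
/-- The accumulated lower-level terms of the site unfolding at the marker `u`, as a recursion along the decoy list with a growing source set `S`:
`subT_S([]) = 0`, `subT_S(d :: ds) = μ(d ↮ S∪Y)⁻¹ · sl_{L_{>d}}[covD_{d,S∪Y}(Φ̃_d)](u) + subT_{S∪{d}}(ds)`. [cite: KozmaNitzan2024, Conj. 4 (p. 32)] -/
def subT (q : V → unitInterval) (x : V) (Y : Set V) (g : Set V → ℝ) (u : V) : Set V → List V → ℝ
  | _, [] => 0
  | S, d :: ds => ((prodBernoulli q).real (avoid Γ d (S ∪ Y)))⁻¹ *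
        slForm (decoyList Γ q (insert d (S ∪ Y)) ds) (covD Γ q d (S ∪ Y) (phiT Γ q x Y g d)) u +
      subT q x Y g u (insert d S) ds

/-- **The `Σ_j` of site Lemma U**: the `{x↮Y}`-average of the world covariance of `g(C_x)` with the unfolded terms `unfoldT` (read in the world) is
MINUS the accumulated lower-level terms `subT`.  Only `x ∈ S` and non-degenerate weights are needed (no condition on the decoys in the site model).
[cite: VandenbergHaggstromKahn2005, §2.1 Lemma 2.4 (p. 10) — corollary] -/
theorem sum_wcov_unfoldT (q : V → unitInterval) (hq : ∀ u, 0 < q u ∧ q u < 1) (x : V) (Y : Set V)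
    (g : Set V → ℝ) (u : V) :
    ∀ (D : List V) (S : Set V), x ∈ S →
      ∑ ω, weight (fun u => (q u : ℝ)) ω * (ind (avoid Γ x Y) ω *
          wcovOff Γ (fun u => (q u : ℝ)) Y (fun β => g (siteCluster Γ β x))
            (fun ζ => CSH.unfoldT (fun a b => b ∈ siteCluster Γ ζ a) S (decoyList Γ q (S ∪ Y) D) u) ω) =
        - subT Γ q x Y g u S D := by
  intro D
  induction D with
  | nil =>
    intro S _
    simp only [decoyList, CSH.unfoldT, subT, neg_zero]
    exact Finset.sum_eq_zero fun ω _ => by rw [wcovOff_zero_right]; ring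
  | cons d ds ih =>
    intro S hxS
    set ŵ : V → ℝ := fun u => (q u : ℝ) with hŵ
    have hm : ∑ ω, weight ŵ ω = 1 := by
      have h1 := integral_prodBernoulli_eq_sum q fun _ => (1 : ℝ)
      simp only [integral_const, probReal_univ, smul_eq_mul, mul_one] at h1
      exact h1.symm
    -- the list unfolds at the head
    have hL : decoyList Γ q (S ∪ Y) (d :: ds) = (d, avoidConst Γ q d (S ∪ Y)) :: decoyList Γ q (insert d (S ∪ Y)) ds := rfl
    have hset : insert d (S ∪ Y) = insert d S ∪ Y := by rw [Set.insert_union]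
    have hm₀ : ∑ ζ, weight ŵ ζ * ind (avoid Γ d (S ∪ Y)) ζ ≠ 0 := sum_ind_avoid_ne_zero q hq d (S ∪ Y)
    -- split the test function
    have hsplit : ∀ ω, wcovOff Γ ŵ Y (fun β => g (siteCluster Γ β x))
        (fun ζ => CSH.unfoldT (fun a b => b ∈ siteCluster Γ ζ a) S (decoyList Γ q (S ∪ Y) (d :: ds)) u) ω =
        wcovOff Γ ŵ Y (fun β => g (siteCluster Γ β x))
          (fun ζ => CSH.av (fun a b => b ∈ siteCluster Γ ζ a) S d *
            slForm (decoyList Γ q (insert d (S ∪ Y)) ds)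
              (fun w' => CSH.chi (fun a b => b ∈ siteCluster Γ ζ a) w' d - avoidConst Γ q d (S ∪ Y) w') u) ω +
        wcovOff Γ ŵ Y (fun β => g (siteCluster Γ β x))
          (fun ζ => CSH.unfoldT (fun a b => b ∈ siteCluster Γ ζ a) (insert d S) (decoyList Γ q (insert d S ∪ Y) ds) u) ω := by
      intro ω
      rw [← wcovOff_add_right, hL]
      simp only [CSH.unfoldT, hset]
    -- the head term: `decoy_world_term`, rewritten with `covD_{d}(Φ̃_d)`
    have hhead := decoy_world_term ŵ hm x Y g hxS d (decoyList Γ q (insert d (S ∪ Y)) ds) u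
      (avoidConst Γ q d (S ∪ Y)) hm₀ (fun w' => avoidConst_eq_div q d (S ∪ Y) w')
    have hQ : (fun w' =>
        (∑ ζ, weight ŵ ζ * ind (avoid Γ d (S ∪ Y)) ζ) *
            (∑ ζ, weight ŵ ζ * (ind (avoid Γ d (S ∪ Y) ∩ siteConn Γ d w') ζ * phiS Γ ŵ x Y g d ζ)) -
          (∑ ζ, weight ŵ ζ * ind (avoid Γ d (S ∪ Y) ∩ siteConn Γ d w') ζ) *
            (∑ ζ, weight ŵ ζ * (ind (avoid Γ d (S ∪ Y)) ζ * phiS Γ ŵ x Y g d ζ))) =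
        covD Γ q d (S ∪ Y) (phiT Γ q x Y g d) := by
      funext w'; rw [covD_phiT_eq]
    rw [hQ, SiteCovTau.sum_weight_ind_eq_real] at hhead
    -- assemble with the induction hypothesis at the source set `S ∪ {d}`
    have htail := ih (insert d S) (Set.mem_insert_of_mem d hxS)
    have e : ∀ ω, weight ŵ ω * (ind (avoid Γ x Y) ω * wcovOff Γ ŵ Y (fun β => g (siteCluster Γ β x))
        (fun ζ => CSH.unfoldT (fun a b => b ∈ siteCluster Γ ζ a) S (decoyList Γ q (S ∪ Y) (d :: ds)) u) ω) =
        weight ŵ ω * (ind (avoid Γ x Y) ω * wcovOff Γ ŵ Y (fun β => g (siteCluster Γ β x))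
          (fun ζ => CSH.av (fun a b => b ∈ siteCluster Γ ζ a) S d *
            slForm (decoyList Γ q (insert d (S ∪ Y)) ds)
              (fun w' => CSH.chi (fun a b => b ∈ siteCluster Γ ζ a) w' d - avoidConst Γ q d (S ∪ Y) w') u) ω) +
        weight ŵ ω * (ind (avoid Γ x Y) ω * wcovOff Γ ŵ Y (fun β => g (siteCluster Γ β x))
          (fun ζ => CSH.unfoldT (fun a b => b ∈ siteCluster Γ ζ a) (insert d S) (decoyList Γ q (insert d S ∪ Y) ds) u) ω) := by
      intro ω; rw [hsplit]; ring
    rw [Finset.sum_congr rfl (fun ω _ => e ω), Finset.sum_add_distrib, hhead, htail]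
    simp only [subT, hset]
    ring

end SiteCSH

end Summit.CriticalPhenomena.PercolationContinuityZ3.Theorems.Transplant
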